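import Literature.Geometry.Kaehler.ComplexTorusHodgeGroupProductCMEllipticCurveCenterEmbedding
import Literature.Geometry.Kaehler.ComplexTorusStablyNondegenerateNonCMEllipticFactor
import Literature.Geometry.Kaehler.ComplexTorusStablyNondegenerateEllipticFactors
import Literature.Geometry.Kaehler.ComplexTorusAbelianSurfaceShimura
import Literature.Geometry.Kaehler.ComplexTorusAbelianSurfaceStablyNondegenerate
import HarnessLib

/-!
# Moonen–Zarhin 1999 (5.2): the centre of `End⁰` of a SIMPLE abelian SURFACE contains no imaginary quadratic field;
# hence `Hg(Y × E) = Hg(Y) × Hg(E)` for every simple abelian surface `Y` and every elliptic curve `E`, and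
# `Y × E` is stably nondegenerate for EVERY abelian surface `Y` and every elliptic curve `E`

Layer `Literature/Geometry/Kaehler`, namespace `Literature.Geometry.Kaehler.ComplexTorus`; lane `lit-hodgefound`
(Track 2 foundations library), Layer A4 (known cases of `D = B`), prover seat `lit-hodgefound-p17` (generation 51),
self-proposed row g51-#1 — the non-simple half of Moonen–Zarhin's «for every complex abelian variety `X` of dimension
`≤ 3` we have `Hg(X) = Sp_D(V,φ)` and condition (D) is satisfied», paragraph (5.2), at torus level.  THEOREMS ONLY (no
definition, no instance, no notation, no named fact; D-0026, net debt 0).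

## Sources, VERBATIM (held copies, re-read on the materialised pages)

* B. J. J. Moonen, Yu. G. Zarhin [MoonenZarhin1999LowDim], *Hodge classes on abelian varieties of low dimension*,
  Math. Ann. **315** (1999), held `paper:arxiv-math_9901113`.  §5 (5.2) (p0008 L101–L111): «Suppose `g = 3`. Suppose
  also that `X` decomposes, up to isogeny, as a product `X ∼ X₁ × X₂` of an elliptic curve `X₁` and a simple abelian
  surface `X₂`. Then the center of `End⁰(X₂)` does not contain an imaginary quadratic field. By Proposition (3.8) it
  follows that `Hg(X) = Hg(X₁) × Hg(X₂)`. Combining this with Corollary (3.9), we have proven (0.1) in case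
  `dim(X) ≤ 3`. In particular, for every complex abelian variety `X` of dimension `≤ 3` we have `Hg(X) = Sp_D(V,φ)`
  and condition (D) in (1.5) is satisfied.»; §2 (2.2) `g = 2` (p0005 L52–L78): «There are four cases. Type I(1) …
  `End⁰(X) = ℚ` … Type I(2): `End⁰(X) = F` is a real quadratic field … Type II(1): `D = End⁰(X)` is a quaternion
  algebra over `ℚ`, split at `∞` … Type IV(2,1): `End⁰(X) = F` is a quartic CM-field not containing an imaginary
  quadratic subfield.»; §4 proof of (4.2) (p0008 L20–L21): «By [Shimura], Propositions 14 and 18, the CM-field `F`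
  does not contain an imaginary quadratic field.»; §3 Prop. (3.8) (p0007 L55–L61): «Let `X` be an abelian variety
  and let `E` be an elliptic curve, both over `ℂ`. Suppose `Hom(E,X) = 0`. Then either `Hg(X × E) = Hg(X) × Hg(E)`
  or `End⁰(E) = k` is an imaginary quadratic field such that there exists an embedding of `k` into the center of
  `End⁰(X)`.»; §3 (3.1) (p0006 L53–L61) and Cor. (3.9) (p0007 L80–L86: «every product of elliptic curves satisfies
  condition (D)»); §1 (D) (p0004 L61–L66).
* K. Hulek, R. Laface [HulekLaface2019PicardNumbersAV], *On the Picard numbers of abelian varieties* (2019), §5.1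
  Prop. 5.1 and its proof (held `paper:arxiv-1703.05882`, p0010): Shimura's exceptional cases (3), (4) at `g = 2`
  («`F` is of type IV, `m = 2`, `d = 1` and `r_ν = s_ν = 1` … `End_ℚ(X)` contains a totally indefinite quaternion
  algebra»), through the tree's `ComplexTorusAbelianSurfaceShimura` (`IsSimple.finrank_neronSeveriGroup_eq_three_of_mul_self_eq_smul`:
  an endomorphism `W` with `W² = q < 0` of a simple abelian surface forces `ρ(X) = 3` and Albert type II, whose
  centre is totally real).
* G. Shimura [Shimura1963AnalyticFamilies], *On analytic families of polarized abelian varieties and automorphic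
  functions*, Ann. of Math. 78 (1963), §4 Propositions 14, 18 (paywalled here; cited through Moonen–Zarhin and Hulek–Laface).
* B. B. Gordon [Gordon1997], *A survey of the Hodge conjecture for abelian varieties* (held `paper:arxiv-alg-geom_9709030`),
  7.6.1–7.6.2 (Hazama's remarks on stable nondegeneracy).
* B. van Geemen [vanGeemen1994HodgeAV], *An introduction to the Hodge conjecture for abelian varieties*, §4 Thm. 4.3 (Tate:
  powers and products of elliptic curves).
* H. Lange [Lange2023AbelianVarietiesComplex], *Abelian Varieties over the Complex Numbers* (2023), §5.1.5 Exercise (2)(a)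
  (a non-simple abelian surface is isogenous to a product of elliptic curves), §1.1.2 (products of tori).

## The argument (following (5.2); deviations recorded)

Moonen–Zarhin prove «the center of `End⁰(X₂)` does not contain an imaginary quadratic field» by the case list (2.2)
(Shimura's Propositions 14 and 18 for Type IV(2,1)).  Here (§1) this is read off the tree's Shimura file: an element
`w` of the centre `K` of `End⁰(Y)` with `w² = r ∈ ℚ_{<0}` would be an endomorphism `W` with `W² = r·1`, which forces
Albert type II with TOTALLY REAL centre (`ComplexTorusAbelianSurfaceShimura` §6) — but no totally real field contains a
square root of a negative rational.  In embedding form: no complex embedding `φ : K → ℂ` takes an imaginary quadratic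
value (if `φ(c)² + pφ(c) + q = 0` with `φ(c) ∉ ℝ` then `w = 2c + p` has `w² = p² − 4q < 0`).  §2 is then Prop. (3.8)
in the tree's CM form (`ComplexTorusHodgeGroupProductCMEllipticCurveCenterEmbedding`: `Hg(Y × E_τ) ≠ Hg(Y) × Hg(E_τ)`
for `E_τ` with complex multiplication gives an eigencharacter `χ` of the centre with `τ ∈ χ(K)`, `τ` imaginary
quadratic) together with the non-CM form (`ComplexTorusStablyNondegenerateNonCMEllipticFactor` §5: a simple `Y` of
dimension `≠ 1` has `Hom(E_τ, Y) = 0`, so the Hodge group splits by Lemma (3.5)).  §3: with the Hodge group split,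
(3.1) in the tree's form (`forall_divisorClasses_powPeriod_prod_eq_hodgeClasses_of_hodgeGroupC_prod_eq`) and condition
(D) for simple abelian surfaces (`ComplexTorusAbelianSurfaceStablyNondegenerate`) and for powers of `E_τ` (Tate) give
(D) for `Y × E_τ`; a NON-simple surface is isogenous to `E_{σ₀} × E_{σ₁}`, so `Y × E_τ ∼ E_{σ₀} × E_{σ₁} × E_τ` is a
product of three elliptic curves (Cor. (3.9) in the tree, `ComplexTorusStablyNondegenerateEllipticFactors` §1).

## Contents

* §0 plumbing: `(E_{ρ₀} × ⋯ × E_{ρ_{N−1}}) × E_{ρ_N} ≅ E_{ρ₀} × ⋯ × E_{ρ_N}` (`isIsomorphic_prodPeriod_piPeriod_ellipticPeriod_castSucc`).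
* §1 **`IsSimple.sq_ne_algebraMap_of_neg_of_finrank_eq_two`** (the centre of `End⁰` of a simple abelian surface contains
  no square root of a negative rational: no imaginary quadratic subfield) and its embedding form
  **`IsSimple.im_eq_zero_of_sq_add_eq_zero_of_finrank_eq_two`**.
* §2 **`IsSimple.hodgeGroupC_prod_ellipticPeriod_eq_blockDiagProd_of_finrank_eq_two`**: `Hg(Y × E_τ)(ℂ) = Hg(Y)(ℂ) × Hg(E_τ)(ℂ)`
  for every simple polarised abelian surface `Y` and EVERY elliptic curve `E_τ` ((5.2)); the `IsAbelianVariety` form; the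
  Künneth form of the Hodge classes of `Y × E_τ` and the dimension formula `dim Bᵖ(Y × E_τ) = Σ_{a+b=p} dim Bᵃ(Y)·dim Bᵇ(E_τ)`.
* §3 **`IsSimple.forall_divisorClasses_powPeriod_prod_ellipticPeriod_eq_hodgeClasses_of_finrank_eq_two`** (`Y × E_τ`
  satisfies (D) for simple `Y`), **`IsRiemannForm.forall_divisorClasses_powPeriod_prod_ellipticPeriod_eq_hodgeClasses_of_finrank_eq_two`**
  (EVERY polarised abelian surface `Y`: `ℬ•((Y × E_τ)ⁿ) = 𝒟•((Y × E_τ)ⁿ)` for all `n`), the `E_τ × Y` orientation and the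
  `IsAbelianVariety` forms.
-/

noncomputable section

open Module Matrix NumberField

namespace Literature.Geometry.Kaehler

namespace ComplexTorus

/-! ## §0 Plumbing: complex numbers with rational square; appending an elliptic curve to a finite product -/

section Plumbing

/-- A non-real complex number whose square is a rational `r` has `r < 0` (it is purely imaginary). [folklore] -/
private theorem ratCast_neg_of_sq_eq₅₁ {z : ℂ} {r : ℚ} (hz : z ^ 2 = (r : ℂ)) (him : z.im ≠ 0) : r < 0 := by
  have hre : (z ^ 2).re = (r : ℝ) := by rw [hz, Complex.ratCast_re]
  have him2 : (z ^ 2).im = 0 := by rw [hz, Complex.ratCast_im]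
  rw [sq, Complex.mul_im] at him2
  rw [sq, Complex.mul_re] at hre
  have hre0 : z.re = 0 := by
    have h2 : 2 * (z.re * z.im) = 0 := by linear_combination him2
    rcases mul_eq_zero.1 h2 with h | h
    · norm_num at h
    · exact (mul_eq_zero.1 h).resolve_right him
  rw [hre0, zero_mul, zero_sub] at hre
  have hpos : 0 < z.im * z.im := mul_self_pos.2 him
  have hr : (r : ℝ) < 0 := by linarith
  exact_mod_cast hr

/-- Completing the square: `z² + pz + q = 0` gives `(2z + p)² = p² − 4q`. [folklore] -/
private theorem sq_two_mul_add_eq₅₁ {z : ℂ} {p q : ℚ} (h : z ^ 2 + p * z + q = 0) :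
    (2 * z + p) ^ 2 = ((p ^ 2 - 4 * q : ℚ) : ℂ) := by
  push_cast
  linear_combination 4 * h

/-- `E_τ = E_{τ'}` as period presentations when `τ = τ'`. [folklore] -/
private theorem ellipticPeriod_congr₅₁ {τ τ' : ℂ} {hτ : τ.im ≠ 0} {hτ' : τ'.im ≠ 0} (h : τ = τ') :
    ellipticPeriod hτ = ellipticPeriod hτ' := by
  subst h
  rfl

/-- The family `(σ₀, …, σ_{N−1}, τ)` of non-real periods. [folklore] -/
private theorem forall_im_snoc_ne_zero₅₁ {N : ℕ} {σ : Fin N → ℂ} (hσ : ∀ k, (σ k).im ≠ 0) {τ : ℂ} (hτ : τ.im ≠ 0) :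
    ∀ k, ((Fin.snoc σ τ : Fin (N + 1) → ℂ) k).im ≠ 0 := fun k ↦ by
  induction k using Fin.lastCases with
  | last => rwa [Fin.snoc_last]
  | cast i => rw [Fin.snoc_castSucc]; exact hσ i

/-- **`(E_{ρ₀} × ⋯ × E_{ρ_{N−1}}) × E_{ρ_N} ≅ E_{ρ₀} × ⋯ × E_{ρ_N}`** — appending one more elliptic curve to a finite product of
elliptic curves is, up to isomorphism of complex tori, the finite product over the longer family (the tree's
`isIsomorphic_piPeriod_succ`, read backwards, with the last period renamed).
[cite: Lange2023AbelianVarietiesComplex, §1.1.2 (products of complex tori, p. 21)] -/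
theorem isIsomorphic_prodPeriod_piPeriod_ellipticPeriod_castSucc {N : ℕ} {ρ : Fin (N + 1) → ℂ}
    (hρ : ∀ k, (ρ k).im ≠ 0) {τ : ℂ} (hτ : τ.im ≠ 0) (hlast : ρ (Fin.last N) = τ) :
    IsIsomorphic (prodPeriod (piPeriod fun k : Fin N ↦ ellipticPeriod (hρ k.castSucc)) (ellipticPeriod hτ))
      (piPeriod fun k ↦ ellipticPeriod (hρ k)) := by
  have h2 : ellipticPeriod (hρ (Fin.last N)) = ellipticPeriod hτ := ellipticPeriod_congr₅₁ hlast
  have e := isIsomorphic_piPeriod_succ (fun k ↦ ellipticPeriod (hρ k))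
  rw [h2] at e
  exact e.symm

end Plumbing

/-! ## §1 The centre of the endomorphism algebra of a simple abelian surface contains no imaginary quadratic field -/

section Centre

variable {κ : Type} [Fintype κ] [DecidableEq κ] [Nonempty κ] {E : Type} [NormedAddCommGroup E] [NormedSpace ℂ E]
  [FiniteDimensional ℂ E] {Ψ : (κ → ℝ) ≃L[ℝ] E} {η : E [⋀^Fin 2]→L[ℝ] ℝ}

omit [FiniteDimensional ℂ E] in
/-- `K ↪ M_κ(ℚ)` sends the rational `r` to the scalar matrix `r·1`. [folklore] -/
private theorem centerField_val_algebraMap₅₁ (hX : IsSimple Ψ) (r : ℚ) :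
    centerField.val Ψ hX (algebraMap ℚ (centerField Ψ hX) r) = r • (1 : Matrix κ κ ℚ) := by
  rw [← centerField.valAlgHom_apply, AlgHom.commutes, Algebra.algebraMap_eq_smul_one]

/-- **THE CENTRE OF `End⁰(Y)` OF A SIMPLE ABELIAN SURFACE CONTAINS NO IMAGINARY QUADRATIC FIELD** — no element `w` of the
centre `K` has `w² = r` with `r ∈ ℚ` negative (an imaginary quadratic subfield `ℚ(√r) ⊆ K` would provide one).  By the
case list (2.2): `K = ℚ`, a real quadratic field, `ℚ` (Type II(1)), or «a quartic CM-field not containing an imaginary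
quadratic subfield» (Type IV(2,1), Shimura's Propositions 14 and 18).  Proof here: `W = w ∈ End⁰(Y)` with `W² = r·1`,
`r < 0`, forces `ρ(Y) = 3` and Albert type II (the tree's `IsSimple.finrank_neronSeveriGroup_eq_three_of_mul_self_eq_smul`),
whose centre is totally real; but `φ(w)² = r < 0` for a (real) complex embedding `φ` of `K`.
[cite: MoonenZarhin1999LowDim, §5 (5.2) (p0008 L101–L104: «the center of `End⁰(X₂)` does not contain an imaginary quadratic field»), §2 (2.2) `g = 2` (p0005 L52–L78) and §4 proof of (4.2) (p0008 L20–L21)]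
[cite: HulekLaface2019PicardNumbersAV, §5.1 Prop. 5.1, exceptional cases (3), (4) and their proof]
[cite: Shimura1963AnalyticFamilies, §4 Props. 14, 18 (via Moonen–Zarhin and Hulek–Laface)] -/
theorem IsSimple.sq_ne_algebraMap_of_neg_of_finrank_eq_two (hX : IsSimple Ψ) (hη : IsRiemannForm Ψ η)
    (hg : finrank ℂ E = 2) (w : centerField Ψ hX) {r : ℚ} (hr : r < 0) :
    w ^ 2 ≠ algebraMap ℚ (centerField Ψ hX) r := by
  intro hw
  obtain ⟨G, hG⟩ := hη.exists_ratMatrix_latticeGram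
  have hWW : centerField.val Ψ hX w * centerField.val Ψ hX w = r • (1 : Matrix κ κ ℚ) := by
    rw [← map_mul, ← sq, hw, centerField_val_algebraMap₅₁]
  -- an endomorphism with negative rational square: `ρ(Y) = 3`, Albert type II, totally real centre
  haveI : IsTotallyReal (centerField Ψ hX) :=
    (hX.finrank_neronSeveriGroup_eq_three_of_mul_self_eq_smul hη hG hg (centerField.val_mem Ψ hX w) hr hWW).2.isTotallyReal
  -- every complex embedding of a totally real field is real, so `φ(w)² = r ≥ 0`
  obtain ⟨v⟩ := (inferInstance : Nonempty (InfinitePlace (centerField Ψ hX)))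
  have hreal := IsTotallyReal.complexEmbedding_isReal v.embedding
  have h1 : (v.embedding w) ^ 2 = (r : ℂ) := by
    rw [← map_pow, hw]
    exact eq_ratCast (v.embedding.comp (algebraMap ℚ (centerField Ψ hX))) r
  have him : (v.embedding w).im = 0 := by
    rw [← hreal.coe_embedding_apply w, Complex.ofReal_im]
  have hre : ((v.embedding w) ^ 2).re = (r : ℝ) := by rw [h1, Complex.ratCast_re]
  rw [sq, Complex.mul_re, him, mul_zero, sub_zero] at hre
  have h0 : (0 : ℝ) ≤ r := by rw [← hre]; exact mul_self_nonneg _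
  exact absurd hr (not_lt.2 (by exact_mod_cast h0))

/-- **NO COMPLEX EMBEDDING OF THE CENTRE OF `End⁰(Y)` (`Y` a simple abelian surface) TAKES AN IMAGINARY QUADRATIC VALUE**:
if `φ : K → ℂ` is a ring embedding and `φ(c)² + p·φ(c) + q = 0` with `p, q ∈ ℚ`, then `φ(c)` is real — the form of
«the center of `End⁰(X₂)` does not contain an imaginary quadratic field» consumed by Proposition (3.8) («an embedding
of `k` into the center of `End⁰(X)`»).  (`w = 2c + p ∈ K` has `w² = p² − 4q`, negative if `φ(c) ∉ ℝ`; previous theorem.)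
[cite: MoonenZarhin1999LowDim, §5 (5.2) (p0008 L101–L105) and §3 Prop. (3.8) (p0007 L55–L61)]
[cite: HulekLaface2019PicardNumbersAV, §5.1 Prop. 5.1, exceptional cases (3), (4)] -/
theorem IsSimple.im_eq_zero_of_sq_add_eq_zero_of_finrank_eq_two (hX : IsSimple Ψ) (hη : IsRiemannForm Ψ η)
    (hg : finrank ℂ E = 2) (φ : centerField Ψ hX →+* ℂ) (c : centerField Ψ hX) {p q : ℚ}
    (h : φ c ^ 2 + p * φ c + q = 0) : (φ c).im = 0 := by
  by_contra him
  set w : centerField Ψ hX := 2 * c + algebraMap ℚ (centerField Ψ hX) p with hw_def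
  have hp : φ (algebraMap ℚ (centerField Ψ hX) p) = (p : ℂ) := eq_ratCast (φ.comp (algebraMap ℚ (centerField Ψ hX))) p
  have hφw : φ w = 2 * φ c + p := by rw [hw_def, map_add, map_mul, map_ofNat, hp]
  have hz : (φ w) ^ 2 = ((p ^ 2 - 4 * q : ℚ) : ℂ) := by rw [hφw]; exact sq_two_mul_add_eq₅₁ h
  have hzim : (φ w).im ≠ 0 := by
    rw [hφw]
    simpa using him
  have hr : p ^ 2 - 4 * q < 0 := ratCast_neg_of_sq_eq₅₁ hz hzim
  have hw2 : w ^ 2 = algebraMap ℚ (centerField Ψ hX) (p ^ 2 - 4 * q) := by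
    apply φ.injective
    rw [map_pow, hz]
    exact (eq_ratCast (φ.comp (algebraMap ℚ (centerField Ψ hX))) _).symm
  exact hX.sq_ne_algebraMap_of_neg_of_finrank_eq_two hη hg w hr hw2

end Centre

/-! ## §2 (5.2): `Hg(Y × E) = Hg(Y) × Hg(E)` for a simple abelian surface `Y` and ANY elliptic curve `E` -/

section HodgeGroup

variable {κ : Type} [Fintype κ] [DecidableEq κ] [Nonempty κ] {E : Type} [NormedAddCommGroup E] [NormedSpace ℂ E]
  [FiniteDimensional ℂ E] {Ψ : (κ → ℝ) ≃L[ℝ] E} {η : E [⋀^Fin 2]→L[ℝ] ℝ} {τ : ℂ} (hτ : τ.im ≠ 0)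

/-- **MOONEN–ZARHIN (5.2): `Hg(Y × E_τ)(ℂ) = Hg(Y)(ℂ) × Hg(E_τ)(ℂ)` FOR EVERY SIMPLE POLARISED ABELIAN SURFACE `Y` AND EVERY
ELLIPTIC CURVE `E_τ`** («the center of `End⁰(X₂)` does not contain an imaginary quadratic field. By Proposition (3.8) it
follows that `Hg(X) = Hg(X₁) × Hg(X₂)`»).  `E_τ` without complex multiplication: `Hom(E_τ, Y) = 0` as `Y` is simple of
dimension `2 ≠ 1`, Lemma (3.5) ∕ (3.8) in the tree; `E_τ` with complex multiplication by `k = ℚ(τ)`: a non-split Hodge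
group gives an eigencharacter `χ` of the centre `K` of `End⁰(Y)` with `τ ∈ χ(K)` (the tree's CM half of (3.8)), against §1.
[cite: MoonenZarhin1999LowDim, §5 (5.2) (p0008 L101–L105), §3 Prop. (3.8) (p0007 L55–L74) and Lemma (3.5)] -/
theorem IsSimple.hodgeGroupC_prod_ellipticPeriod_eq_blockDiagProd_of_finrank_eq_two (hX : IsSimple Ψ)
    (hη : IsRiemannForm Ψ η) (hg : finrank ℂ E = 2) :
    hodgeGroupC (prodPeriod Ψ (ellipticPeriod hτ)) = blockDiagProd (hodgeGroupC Ψ) (hodgeGroupC (ellipticPeriod hτ)) := by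
  by_cases hE : ellipticEnd hτ = ⊥
  · exact hX.hodgeGroupC_prod_ellipticPeriod_eq_blockDiagProd_of_card_ne hτ ⟨η, hη⟩ hE
      (by rw [card_eq_two_mul_finrank Ψ, hg]; norm_num)
  · by_contra hne
    obtain ⟨-, -, χ, -, hτχ⟩ := hη.exists_eigencharacter_center_endAlgRat_of_hodgeGroupC_prod_ellipticPeriod_ne hτ hE hne
    obtain ⟨c, hc⟩ := (AlgHom.mem_range χ).1 hτχ
    obtain ⟨p, q, hpq⟩ := (ellipticEnd_ne_bot_iff hτ).1 hE
    -- `χ` as a ring embedding `φ` of the centre FIELD `K` of `End⁰(Y)`; `φ(c) = χ(c) = τ` is imaginary quadratic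
    obtain ⟨φ, hφ⟩ : ∃ φ : centerField Ψ hX →+* ℂ, ∀ x, φ x = χ x := ⟨χ.toRingHom, fun _ ↦ rfl⟩
    have hc' : φ c = τ := (hφ c).trans hc
    have him := hX.im_eq_zero_of_sq_add_eq_zero_of_finrank_eq_two hη hg φ c (p := p) (q := q) (by rw [hc']; exact hpq)
    rw [hc'] at him
    exact hτ him

/-- The `IsAbelianVariety` form: **`Hg(Y × E_τ)(ℂ) = Hg(Y)(ℂ) × Hg(E_τ)(ℂ)` for every simple complex abelian surface `Y`
and every elliptic curve `E_τ`.** [cite: MoonenZarhin1999LowDim, §5 (5.2) (p0008 L101–L105) and §3 Prop. (3.8)] -/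
theorem IsSimple.hodgeGroupC_prod_ellipticPeriod_eq_blockDiagProd_of_finrank_eq_two' (hX : IsSimple Ψ)
    (hA : IsAbelianVariety Ψ) (hg : finrank ℂ E = 2) :
    hodgeGroupC (prodPeriod Ψ (ellipticPeriod hτ)) = blockDiagProd (hodgeGroupC Ψ) (hodgeGroupC (ellipticPeriod hτ)) := by
  obtain ⟨η, hη⟩ := hA
  exact hX.hodgeGroupC_prod_ellipticPeriod_eq_blockDiagProd_of_finrank_eq_two hτ hη hg

/-- **(3.1) for `Y × E_τ`, `Y` a simple abelian surface: the Hodge classes of `Y × E_τ` are spanned by the cross products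
`γ ∧ δ` of Hodge classes of the factors** (Künneth form of the split Hodge group: «`Hg(X₁ × X₂) ≠ Hg(X₁) × Hg(X₂)` … holds
if and only if for some `m` and `n` the Hodge ring `ℬ•(X₁^m × X₂^n)` is not generated by the elements coming from
`ℬ•(X₁^m)` and `ℬ•(X₂^n)`»). [cite: MoonenZarhin1999LowDim, §3 (3.1) (p0006 L53–L61) and §5 (5.2)] -/
theorem IsSimple.hodgeClasses_prod_ellipticPeriod_eq_span_cross_of_finrank_eq_two (hX : IsSimple Ψ)
    (hη : IsRiemannForm Ψ η) (hg : finrank ℂ E = 2) (p : ℕ) :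
    hodgeClasses (prodPeriod Ψ (ellipticPeriod hτ)) p = Submodule.span ℚ
      {x | ∃ (a b : ℕ) (h : 2 * a + 2 * b = 2 * p) (γ : E [⋀^Fin (2 * a)]→L[ℝ] ℂ) (δ : ℂ [⋀^Fin (2 * b)]→L[ℝ] ℂ),
        γ ∈ hodgeClasses Ψ a ∧ δ ∈ hodgeClasses (ellipticPeriod hτ) b ∧
          x = ((γ.compContinuousLinearMap (ContinuousLinearMap.fst ℝ E ℂ)).wedge
            (δ.compContinuousLinearMap (ContinuousLinearMap.snd ℝ E ℂ))).domDomCongr (finCongr h)} :=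
  hodgeClasses_prod_eq_span_cross_of_hodgeGroupC_prod_eq
    (hX.hodgeGroupC_prod_ellipticPeriod_eq_blockDiagProd_of_finrank_eq_two hτ hη hg) p

/-- **`dim Bᵖ(Y × E_τ) = Σ_{a+b=p} dim Bᵃ(Y) · dim Bᵇ(E_τ)`** for a simple polarised abelian surface `Y` and any elliptic
curve `E_τ`. [cite: MoonenZarhin1999LowDim, §3 (3.1) and §5 (5.2)] -/
theorem IsSimple.finrank_hodgeClasses_prod_ellipticPeriod_eq_sum_of_finrank_eq_two (hX : IsSimple Ψ)
    (hη : IsRiemannForm Ψ η) (hg : finrank ℂ E = 2) (p : ℕ) :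
    finrank ℚ (hodgeClasses (prodPeriod Ψ (ellipticPeriod hτ)) p) =
      ∑ ab ∈ Finset.HasAntidiagonal.antidiagonal p,
        finrank ℚ (hodgeClasses Ψ ab.1) * finrank ℚ (hodgeClasses (ellipticPeriod hτ) ab.2) :=
  finrank_hodgeClasses_prod_eq_sum_of_hodgeGroupC_prod_eq
    (hX.hodgeGroupC_prod_ellipticPeriod_eq_blockDiagProd_of_finrank_eq_two hτ hη hg) p

end HodgeGroup

/-! ## §3 Condition (D) for `Y × E`: every abelian surface `Y`, every elliptic curve `E` -/

section StablyNondegenerate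

variable {κ : Type} [Fintype κ] [DecidableEq κ] [Nonempty κ] {E : Type} [NormedAddCommGroup E] [NormedSpace ℂ E]
  [FiniteDimensional ℂ E] {Ψ : (κ → ℝ) ≃L[ℝ] E} {η : E [⋀^Fin 2]→L[ℝ] ℝ} {τ : ℂ} (hτ : τ.im ≠ 0)

/-- **`Y × E_τ` SATISFIES CONDITION (D) — `ℬ•((Y × E_τ)ⁿ) = 𝒟•((Y × E_τ)ⁿ)` for all `n` — for every SIMPLE polarised abelian
surface `Y` and every elliptic curve `E_τ`**: the Hodge group splits (§2), `Y` satisfies (D) (the tree's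
`IsSimple.forall_divisorClasses_powPeriod_eq_hodgeClasses_of_finrank_eq_two`) and so does `E_τ` (Tate), hence so does the
product ((3.1)). [cite: MoonenZarhin1999LowDim, §5 (5.2) (p0008 L101–L111), §3 (3.1) and §1 (D) (p0004 L61–L66)]
[cite: Gordon1997, 7.6.2] [cite: vanGeemen1994HodgeAV, §4 Thm. 4.3] -/
theorem IsSimple.forall_divisorClasses_powPeriod_prod_ellipticPeriod_eq_hodgeClasses_of_finrank_eq_two (hX : IsSimple Ψ)
    (hη : IsRiemannForm Ψ η) (hg : finrank ℂ E = 2) :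
    ∀ k p, divisorClasses (powPeriod (prodPeriod Ψ (ellipticPeriod hτ)) k) p =
      hodgeClasses (powPeriod (prodPeriod Ψ (ellipticPeriod hτ)) k) p :=
  forall_divisorClasses_powPeriod_prod_eq_hodgeClasses_of_hodgeGroupC_prod_eq
    (hX.hodgeGroupC_prod_ellipticPeriod_eq_blockDiagProd_of_finrank_eq_two hτ hη hg)
    (hX.forall_divisorClasses_powPeriod_eq_hodgeClasses_of_finrank_eq_two hη hg)
    (fun k p ↦ divisorClasses_eq_hodgeClasses_ellipticPow hτ k p)

/-- **MOONEN–ZARHIN (5.2) WITH COR. (3.9): `Y × E_τ` SATISFIES CONDITION (D) FOR EVERY POLARISED ABELIAN SURFACE `Y` AND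
EVERY ELLIPTIC CURVE `E_τ`** — `ℬ•((Y × E_τ)ⁿ) = 𝒟•((Y × E_τ)ⁿ)` for all `n` (simple `Y`: previous theorem; non-simple `Y`:
`Y ∼ E_{σ₀} × E_{σ₁}` and «every product of elliptic curves satisfies condition (D)»).
[cite: MoonenZarhin1999LowDim, §5 (5.2) (p0008 L101–L111: «Combining this with Corollary (3.9), we have proven (0.1) in case `dim(X) ≤ 3`») and §3 Cor. (3.9) (p0007 L80–L86)]
[cite: Lange2023AbelianVarietiesComplex, §5.1.5 Exercise (2)(a)] [cite: vanGeemen1994HodgeAV, §4 Thm. 4.3] -/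
theorem IsRiemannForm.forall_divisorClasses_powPeriod_prod_ellipticPeriod_eq_hodgeClasses_of_finrank_eq_two
    (hη : IsRiemannForm Ψ η) (hg : finrank ℂ E = 2) :
    ∀ k p, divisorClasses (powPeriod (prodPeriod Ψ (ellipticPeriod hτ)) k) p =
      hodgeClasses (powPeriod (prodPeriod Ψ (ellipticPeriod hτ)) k) p := by
  by_cases hX : IsSimple Ψ
  · exact hX.forall_divisorClasses_powPeriod_prod_ellipticPeriod_eq_hodgeClasses_of_finrank_eq_two hτ hη hg
  · -- `Y ∼ E_{σ₀} × E_{σ₁}`, so `Y × E_τ ∼ (E_{σ₀} × E_{σ₁}) × E_τ ≅ E_{σ₀} × E_{σ₁} × E_τ`, a product of elliptic curves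
    obtain ⟨σ, hσ, hY⟩ := hη.exists_isIsogenous_piPeriod_ellipticPeriod_of_not_isSimple_of_finrank_eq_two hg hX
    have hρ := forall_im_snoc_ne_zero₅₁ hσ hτ
    have hfam : (fun k ↦ ellipticPeriod (hσ k)) = fun k : Fin 2 ↦ ellipticPeriod (hρ k.castSucc) :=
      funext fun k ↦ ellipticPeriod_congr₅₁ (by simp)
    rw [hfam] at hY
    exact (IsIsogenous.trans _ _ _ (hY.prod (IsIsogenous.refl (ellipticPeriod hτ)))
      (isIsomorphic_prodPeriod_piPeriod_ellipticPeriod_castSucc hρ hτ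
        (by rw [Fin.snoc_last])).isIsogenous).forall_divisorClasses_powPeriod_eq_hodgeClasses_of_pi_ellipticPeriod hρ

/-- The `IsAbelianVariety` form: **`Y × E_τ` satisfies condition (D) for every complex abelian surface `Y` and every
elliptic curve `E_τ`.** [cite: MoonenZarhin1999LowDim, §5 (5.2) (p0008 L101–L111) and §3 Cor. (3.9)] -/
theorem IsAbelianVariety.forall_divisorClasses_powPeriod_prod_ellipticPeriod_eq_hodgeClasses_of_finrank_eq_two
    (hA : IsAbelianVariety Ψ) (hg : finrank ℂ E = 2) :
    ∀ k p, divisorClasses (powPeriod (prodPeriod Ψ (ellipticPeriod hτ)) k) p =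
      hodgeClasses (powPeriod (prodPeriod Ψ (ellipticPeriod hτ)) k) p := by
  obtain ⟨η, hη⟩ := hA
  exact hη.forall_divisorClasses_powPeriod_prod_ellipticPeriod_eq_hodgeClasses_of_finrank_eq_two hτ hg

/-- The `E_τ × Y` orientation: **`E_τ × Y` satisfies condition (D) for every polarised abelian surface `Y` and every
elliptic curve `E_τ`** (`E_τ × Y ≅ Y × E_τ`). [cite: MoonenZarhin1999LowDim, §5 (5.2) (p0008 L101–L111)] [cite: Lange2023AbelianVarietiesComplex, §1.1.2] -/
theorem IsRiemannForm.forall_divisorClasses_powPeriod_ellipticPeriod_prod_eq_hodgeClasses_of_finrank_eq_two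
    (hη : IsRiemannForm Ψ η) (hg : finrank ℂ E = 2) :
    ∀ k p, divisorClasses (powPeriod (prodPeriod (ellipticPeriod hτ) Ψ) k) p =
      hodgeClasses (powPeriod (prodPeriod (ellipticPeriod hτ) Ψ) k) p :=
  (isIsomorphic_prodPeriod_comm (ellipticPeriod hτ) Ψ).isIsogenous.forall_powPeriod_divisorClasses_eq_hodgeClasses_iff.2
    (hη.forall_divisorClasses_powPeriod_prod_ellipticPeriod_eq_hodgeClasses_of_finrank_eq_two hτ hg)

/-- The `IsAbelianVariety` form of the `E_τ × Y` orientation. [cite: MoonenZarhin1999LowDim, §5 (5.2) (p0008 L101–L111)] -/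
theorem IsAbelianVariety.forall_divisorClasses_powPeriod_ellipticPeriod_prod_eq_hodgeClasses_of_finrank_eq_two
    (hA : IsAbelianVariety Ψ) (hg : finrank ℂ E = 2) :
    ∀ k p, divisorClasses (powPeriod (prodPeriod (ellipticPeriod hτ) Ψ) k) p =
      hodgeClasses (powPeriod (prodPeriod (ellipticPeriod hτ) Ψ) k) p := by
  obtain ⟨η, hη⟩ := hA
  exact hη.forall_divisorClasses_powPeriod_ellipticPeriod_prod_eq_hodgeClasses_of_finrank_eq_two hτ hg

/-- The single-power statement: **`Dᵖ(Y × E_τ) = Bᵖ(Y × E_τ)` for every `p`** («the Hodge `(p,p)`-conjecture holds for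
`Y × E`», every complex abelian surface `Y`, every elliptic curve `E`). [cite: MoonenZarhin1999LowDim, §5 (5.2) (p0008 L107–L111) and Introduction (p0001 L62–L64)]
[cite: Lange2023AbelianVarietiesComplex, §7.3.1] -/
theorem IsAbelianVariety.divisorClasses_prod_ellipticPeriod_eq_hodgeClasses_of_finrank_eq_two (hA : IsAbelianVariety Ψ)
    (hg : finrank ℂ E = 2) (p : ℕ) :
    divisorClasses (prodPeriod Ψ (ellipticPeriod hτ)) p = hodgeClasses (prodPeriod Ψ (ellipticPeriod hτ)) p :=
  ((isIsomorphic_powPeriod_one (prodPeriod Ψ (ellipticPeriod hτ))).isIsogenous.divisorClasses_eq_hodgeClasses_iff _ _ p).2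
    (hA.forall_divisorClasses_powPeriod_prod_ellipticPeriod_eq_hodgeClasses_of_finrank_eq_two hτ hg 1 p)

end StablyNondegenerate

end ComplexTorus

end Literature.Geometry.Kaehler
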